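import Mathlib
import Literature.Computability.AlgebraicComplexity.NestFreeMatchingPoly
import Summits.ValiantsHypothesis.ValiantsHypothesis.Theorems.FifoMatchingNNDivisionHardSplitFace
import Summits.ValiantsHypothesis.ValiantsHypothesis.Theorems.FifoMatchingNNMonotoneExpBound
import Summits.ValiantsHypothesis.ValiantsHypothesis.Theorems.FifoMatchingNNMonomialCofactorHard
import Summits.ValiantsHypothesis.ValiantsHypothesis.Theses.FifoMatching
import HarnessLib

/-!
# Route FifoMatching — crux `NNDivisionHard` (stmt-ValiantsHypothesis-21181): BLOCK-AVOIDING COFACTORS ARE NOT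
# CERTIFICATES — interval transport and the block-dense tier, by name

Consequences of the split face (`SplitFace.topComponent_lWeight`) and the linear transport engine with variable control
(`LinearTransport.linear_transport_vars`, `LinearTransport.complexity_le_of_vars_outside`).  An ALIGNED BLOCK of
`[0, 2n)` is an interval `B = [2i, 2i+2b)`; an arc variable `x_(p,q)` is INTERNAL to `B` if `p, q ∈ B`.

* `complexity_nn_le_of_prefixAvoiding`, `complexity_nn_le_of_suffixAvoiding` — if NO variable of the cofactor `h ≠ 0`
  is internal to the prefix block `[0, 2b)` (resp. the suffix block), then `L₊(NN_b) ≤ L₊(NN_n · h) + 2`;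
* `exists_interval_transport` — certificates restrict to every aligned interval block at cost `+2`;
* ★ `complexity_nn_le_of_intervalAvoiding` (`'` = the `i + b ≤ n` form) — **if no variable of `h ≠ 0` is internal to the
  aligned block `[2i, 2i+2b)`, then `L₊(NN_b) ≤ L₊(NN_n · h) + 3`** — ANY degree, ANY number of monomials, and `h` may
  touch every vertex of the block through crossing arcs (contrast: the window-avoidance rung
  `…NNDivisionHardWindowAvoidance` needs ONE monomial avoiding all VERTICES of a window);
* ★★ `intervalAvoiding_not_certificate_qp` — crux currency: **for every `c`, eventually in `n`, every `h ≠ 0` avoiding the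
  internal arcs of some aligned block of half-length `b ≥ (log₂ n + c + 2)^{6(c+1)}` satisfies
  `2^((log₂ n + c)^c) < L₊(NN_n · h) + L₊(h)`** (stretched-exponential bound `2^{b^{1/6}} ≤ L₊(NN_b)` of
  `NNMonotoneExpBound.exp_lower_bound` at the block scale);
* ★ `nnDivisionHard_iff_blockDenseTier` — BY NAME: `Theses.FifoMatching.NNDivisionHard` ⟺ the same inequality for the
  BLOCK-DENSE cofactors (some variable internal to EVERY aligned block of half-length `≥ (log₂ n + c + 2)^{6(c+1)}`).
  The residual of record (cheap, torus-homogeneous, hyper-degree, unsaturated, non-generic, window-dense) thus acquires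
  the independent condition «internally dense in every polylog aligned block».

HONEST FRAMING: a new rung family and a by-name localisation; the block-dense residual stays OPEN (Hrubeš–Yehudayoff 2021
§6 Problem 2); nothing here bears on `NNNotVP` or on VP ≠ VNP (NOT proved).
References: Bürgisser 2000 Rem. 2.7 [Burgisser2000]; Hrubeš–Yehudayoff 2021 §6 Problem 2 [HrubesYehudayoff2021];
Chen–Deng–Du–Stanley–Yan 2007 §1 [ChenDengDuStanleyYan2007].
-/

noncomputable section

-- Sub = Summit single-conjunct layout: the duplicated namespace component is mandated by the tree.
set_option linter.dupNamespace false
set_option autoImplicit false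

namespace Summit.ValiantsHypothesis.ValiantsHypothesis.Theorems.FifoMatching.NNDivisionHard.BlockAvoidance

open Finset MvPolynomial Literature.Computability.AlgebraicComplexity
open Summit.ValiantsHypothesis.ValiantsHypothesis.Theorems.ZeroOneTransfer.Negative (topComponent)
open Summit.ValiantsHypothesis.ValiantsHypothesis.Theorems.FifoMatching.NNDivisionHard.StackPowersQueue
  (blockEmb blockEmb_injective)
open Summit.ValiantsHypothesis.ValiantsHypothesis.Theorems.FifoMatching.NNDivisionHard.LinearTransport
  (linear_transport_vars complexity_le_of_vars_outside)
open Summit.ValiantsHypothesis.ValiantsHypothesis.Theorems.FifoMatching.NNDivisionHard.SplitFace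
  (lWeight shiftR blockEmbR two_mul_le val_shiftR blockEmbR_injective topComponent_lWeight
    support_rename_blockEmbR_outside support_rename_blockEmb_outside exists_prefix_transport exists_suffix_transport)
open scoped NNReal BigOperators

variable {b c : ℕ}

/-! ### §1 Prefix- and suffix-avoiding cofactors -/

/-- The right face factor `ι_R(NN_c)` is nonzero. [folklore] -/
theorem rename_blockEmbR_nn_ne_zero : rename (blockEmbR b c) (nestFreeMatchingPoly c ℝ≥0) ≠ 0 := fun h0 =>
  MonomialCofactor.nn_ne_zero c (rename_injective _ blockEmbR_injective (by rw [h0, map_zero]))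

/-- The left face factor `ι_L(NN_b)` is nonzero. [folklore] -/
theorem rename_blockEmb_nn_ne_zero : rename (blockEmb (two_mul_le b c)) (nestFreeMatchingPoly b ℝ≥0) ≠ 0 := fun h0 =>
  MonomialCofactor.nn_ne_zero b (rename_injective _ (blockEmb_injective (two_mul_le b c)) (by rw [h0, map_zero]))

/-- ★ **PREFIX-AVOIDING COFACTORS.**  If no variable of `h ≠ 0` is internal to the prefix block `[0, 2b)`, then
`L₊(NN_b) ≤ L₊(NN_{b+c} · h) + 2`. [cite: Burgisser2000, Rem. 2.7] -/
theorem complexity_nn_le_of_prefixAvoiding {h : MvPolynomial (Fin (2 * (b + c)) × Fin (2 * (b + c))) ℝ≥0}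
    (hh : h ≠ 0) (havoid : ∀ e ∈ h.vars, ¬ ((e.1 : ℕ) < 2 * b ∧ (e.2 : ℕ) < 2 * b)) :
    complexity (nestFreeMatchingPoly b ℝ≥0) ≤ complexity (nestFreeMatchingPoly (b + c) ℝ≥0 * h) + 2 :=
  complexity_le_of_vars_outside (blockEmb_injective (two_mul_le b c)) (lWeight b c) topComponent_lWeight
    rename_blockEmbR_nn_ne_zero (support_rename_blockEmbR_outside _) hh
    (fun e he hr => by
      obtain ⟨⟨i, j⟩, rfl⟩ := hr
      exact havoid _ he ⟨i.isLt, j.isLt⟩)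

/-- ★ **SUFFIX-AVOIDING COFACTORS.**  If no variable of `h ≠ 0` is internal to the suffix block `[2b, 2(b+c))`, then
`L₊(NN_c) ≤ L₊(NN_{b+c} · h) + 2`. [cite: Burgisser2000, Rem. 2.7] -/
theorem complexity_nn_le_of_suffixAvoiding {h : MvPolynomial (Fin (2 * (b + c)) × Fin (2 * (b + c))) ℝ≥0}
    (hh : h ≠ 0) (havoid : ∀ e ∈ h.vars, ¬ (2 * b ≤ (e.1 : ℕ) ∧ 2 * b ≤ (e.2 : ℕ))) :
    complexity (nestFreeMatchingPoly c ℝ≥0) ≤ complexity (nestFreeMatchingPoly (b + c) ℝ≥0 * h) + 2 :=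
  complexity_le_of_vars_outside blockEmbR_injective (lWeight b c) (topComponent_lWeight.trans (mul_comm _ _))
    rename_blockEmb_nn_ne_zero (support_rename_blockEmb_outside _) hh
    (fun e he hr => by
      obtain ⟨⟨i, j⟩, rfl⟩ := hr
      exact havoid _ he ⟨Nat.le_add_right _ _, Nat.le_add_right _ _⟩)

/-! ### §2 Interval blocks -/

/-- **INTERVAL TRANSPORT.**  Certificates restrict to every aligned interval block `[2i, 2i+2b)` at cost `+2` (suffix,
then prefix). [cite: Burgisser2000, Rem. 2.7] -/
theorem exists_interval_transport {i b c : ℕ}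
    {h : MvPolynomial (Fin (2 * (i + (b + c))) × Fin (2 * (i + (b + c)))) ℝ≥0} (hh : h ≠ 0) :
    ∃ g : MvPolynomial (Fin (2 * b) × Fin (2 * b)) ℝ≥0, g ≠ 0 ∧
      complexity (nestFreeMatchingPoly b ℝ≥0 * g) ≤ complexity (nestFreeMatchingPoly (i + (b + c)) ℝ≥0 * h) + 2 ∧
      complexity g ≤ complexity h := by
  obtain ⟨g₁, h1, h2, h3⟩ := exists_suffix_transport (b := i) (c := b + c) hh
  obtain ⟨g, h4, h5, h6⟩ := exists_prefix_transport (b := b) (c := c) h1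
  exact ⟨g, h4, h5.trans (by omega), h6.trans h3⟩

/-- ★ **INTERVAL-AVOIDING COFACTORS.**  If no variable of `h ≠ 0` is internal to the aligned block `[2i, 2i+2b)` of
`[0, 2(i+b+c))`, then `L₊(NN_b) ≤ L₊(NN_{i+b+c} · h) + 3` (suffix transport with variable control, then the prefix
rung at scale `b + c`). [cite: Burgisser2000, Rem. 2.7] -/
theorem complexity_nn_le_of_intervalAvoiding {i b c : ℕ}
    {h : MvPolynomial (Fin (2 * (i + (b + c))) × Fin (2 * (i + (b + c)))) ℝ≥0} (hh : h ≠ 0)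
    (havoid : ∀ e ∈ h.vars,
      ¬ (2 * i ≤ (e.1 : ℕ) ∧ (e.1 : ℕ) < 2 * i + 2 * b ∧ 2 * i ≤ (e.2 : ℕ) ∧ (e.2 : ℕ) < 2 * i + 2 * b)) :
    complexity (nestFreeMatchingPoly b ℝ≥0) ≤ complexity (nestFreeMatchingPoly (i + (b + c)) ℝ≥0 * h) + 3 := by
  obtain ⟨g, hg0, hgb, -, hvars, -⟩ := linear_transport_vars (blockEmbR_injective (b := i) (c := b + c))
    (lWeight i (b + c)) ((topComponent_lWeight (b := i) (c := b + c)).trans (mul_comm _ _)) rename_blockEmb_nn_ne_zero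
    (support_rename_blockEmb_outside _) hh
  have havoid' : ∀ e ∈ g.vars, ¬ ((e.1 : ℕ) < 2 * b ∧ (e.2 : ℕ) < 2 * b) := by
    rintro ⟨t₁, t₂⟩ ht ⟨ht1, ht2⟩
    change (t₁ : ℕ) < 2 * b at ht1
    change (t₂ : ℕ) < 2 * b at ht2
    refine havoid _ (hvars _ ht) ⟨?_, ?_, ?_, ?_⟩
    · show 2 * i ≤ 2 * i + (t₁ : ℕ); omega
    · show 2 * i + (t₁ : ℕ) < 2 * i + 2 * b; omega
    · show 2 * i ≤ 2 * i + (t₂ : ℕ); omega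
    · show 2 * i + (t₂ : ℕ) < 2 * i + 2 * b; omega
  calc complexity (nestFreeMatchingPoly b ℝ≥0) ≤ complexity (nestFreeMatchingPoly (b + c) ℝ≥0 * g) + 2 :=
        complexity_nn_le_of_prefixAvoiding hg0 havoid'
    _ ≤ complexity (nestFreeMatchingPoly (i + (b + c)) ℝ≥0 * h) + 1 + 2 := by gcongr
    _ = complexity (nestFreeMatchingPoly (i + (b + c)) ℝ≥0 * h) + 3 := by ring

/-- ★ **INTERVAL-AVOIDING COFACTORS, `i + b ≤ n` form.** [cite: Burgisser2000, Rem. 2.7] -/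
theorem complexity_nn_le_of_intervalAvoiding' {n i b : ℕ} (hib : i + b ≤ n)
    {h : MvPolynomial (Fin (2 * n) × Fin (2 * n)) ℝ≥0} (hh : h ≠ 0)
    (havoid : ∀ e ∈ h.vars,
      ¬ (2 * i ≤ (e.1 : ℕ) ∧ (e.1 : ℕ) < 2 * i + 2 * b ∧ 2 * i ≤ (e.2 : ℕ) ∧ (e.2 : ℕ) < 2 * i + 2 * b)) :
    complexity (nestFreeMatchingPoly b ℝ≥0) ≤ complexity (nestFreeMatchingPoly n ℝ≥0 * h) + 3 := by
  obtain ⟨c, rfl⟩ : ∃ c, n = i + (b + c) := ⟨n - i - b, by omega⟩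
  exact complexity_nn_le_of_intervalAvoiding hh havoid

/-! ### §3 Crux currency: block-avoiding cofactors are not quasi-polynomial certificates -/

/-- Exponent bookkeeping: `(ℓ+c)^c + 2 ≤ (ℓ+c+2)^(c+1)` for `ℓ ≥ 1`. [folklore] -/
theorem pow_add_two_le (ℓ c : ℕ) (hℓ : 1 ≤ ℓ) : (ℓ + c) ^ c + 2 ≤ (ℓ + c + 2) ^ (c + 1) := by
  have hE : 1 ≤ (ℓ + c) ^ c := Nat.one_le_pow _ _ (by omega)
  have h1 : (ℓ + c) ^ c ≤ (ℓ + c + 2) ^ c := Nat.pow_le_pow_left (by omega) c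
  calc (ℓ + c) ^ c + 2 ≤ (ℓ + c) ^ c * 3 := by omega
    _ ≤ (ℓ + c + 2) ^ c * (ℓ + c + 2) := Nat.mul_le_mul h1 (by omega)
    _ = (ℓ + c + 2) ^ (c + 1) := (pow_succ _ _).symm

/-- Real bookkeeping: `T⁶ ≤ b` and `2^{b^{1/6}} ≤ X` give `2^T ≤ X`. [folklore] -/
theorem two_pow_le_of_pow_six_le {T b X : ℕ} (hb : T ^ 6 ≤ b)
    (hX : (2 : ℝ) ^ ((b : ℝ) ^ ((1 : ℝ) / 6)) ≤ (X : ℝ)) : 2 ^ T ≤ X := by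
  have h6 : (((T : ℝ) ^ 6)) ^ ((1 : ℝ) / 6) = T := by
    rw [one_div, show (6 : ℝ) = ((6 : ℕ) : ℝ) by norm_num]
    exact Real.pow_rpow_inv_natCast (Nat.cast_nonneg _) (by norm_num)
  have h1 : (T : ℝ) ≤ (b : ℝ) ^ ((1 : ℝ) / 6) := by
    calc (T : ℝ) = ((T : ℝ) ^ 6) ^ ((1 : ℝ) / 6) := h6.symm
      _ ≤ (b : ℝ) ^ ((1 : ℝ) / 6) := Real.rpow_le_rpow (by positivity) (by exact_mod_cast hb) (by norm_num)
  have h2 : (2 : ℝ) ^ (T : ℝ) ≤ (2 : ℝ) ^ ((b : ℝ) ^ ((1 : ℝ) / 6)) :=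
    Real.rpow_le_rpow_of_exponent_le one_le_two h1
  have h3 : ((2 ^ T : ℕ) : ℝ) ≤ (X : ℝ) := by
    rw [Nat.cast_pow, Nat.cast_ofNat, ← Real.rpow_natCast]
    exact h2.trans hX
  exact_mod_cast h3

/-- ★★ **BLOCK-AVOIDING COFACTORS ARE NOT CERTIFICATES.**  For every `c`, eventually in `n`: every cofactor `h ≠ 0` none
of whose variables is internal to some aligned block `[2i, 2i+2b)` with `i + b ≤ n` and `b ≥ (log₂ n + c + 2)^{6(c+1)}`
satisfies the crux inequality `2^((log₂ n + c)^c) < L₊(NN_n · h) + L₊(h)`. [cite: Burgisser2000, Rem. 2.7]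
[cite: HrubesYehudayoff2021, §6 Problem 2] -/
theorem intervalAvoiding_not_certificate_qp (c : ℕ) : ∃ n₀ : ℕ, ∀ n : ℕ, n₀ ≤ n → ∀ i b : ℕ, i + b ≤ n →
    (Nat.log 2 n + c + 2) ^ (6 * (c + 1)) ≤ b →
    ∀ h : MvPolynomial (Fin (2 * n) × Fin (2 * n)) ℝ≥0, h ≠ 0 →
    (∀ e ∈ h.vars,
      ¬ (2 * i ≤ (e.1 : ℕ) ∧ (e.1 : ℕ) < 2 * i + 2 * b ∧ 2 * i ≤ (e.2 : ℕ) ∧ (e.2 : ℕ) < 2 * i + 2 * b)) →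
    2 ^ ((Nat.log 2 n + c) ^ c) < complexity (nestFreeMatchingPoly n ℝ≥0 * h) + complexity h := by
  obtain ⟨n₁, hn₁⟩ := NNMonotoneExpBound.exp_lower_bound
  refine ⟨2 ^ (n₁ + 1), fun n hn i b hib hb h hh havoid => ?_⟩
  have hℓ1 : n₁ + 1 ≤ Nat.log 2 n := Nat.le_log_of_pow_le Nat.one_lt_two hn
  have hT6 : ((Nat.log 2 n + c + 2) ^ (c + 1)) ^ 6 ≤ b := by
    rw [← pow_mul, mul_comm]; exact hb
  have hbT : n₁ ≤ b := by
    have : Nat.log 2 n + c + 2 ≤ (Nat.log 2 n + c + 2) ^ (6 * (c + 1)) := Nat.le_self_pow (by omega) _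
    omega
  have hX := two_pow_le_of_pow_six_le hT6 (hn₁ b hbT)
  have h3 := complexity_nn_le_of_intervalAvoiding' hib hh havoid
  have hTE : (Nat.log 2 n + c) ^ c + 2 ≤ (Nat.log 2 n + c + 2) ^ (c + 1) := pow_add_two_le _ c (by omega)
  have hpow : 2 ^ ((Nat.log 2 n + c) ^ c + 2) ≤ 2 ^ ((Nat.log 2 n + c + 2) ^ (c + 1)) :=
    Nat.pow_le_pow_right Nat.two_pos hTE
  have hE2 : 2 ^ 1 ≤ 2 ^ ((Nat.log 2 n + c) ^ c) :=
    Nat.pow_le_pow_right Nat.two_pos (Nat.one_le_pow _ _ (by omega))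
  have h4 : 2 ^ ((Nat.log 2 n + c) ^ c + 2) = 4 * 2 ^ ((Nat.log 2 n + c) ^ c) := by ring
  omega

/-- ★ **BY NAME: `NNDivisionHard` ⟺ its BLOCK-DENSE tier.**  The crux (stmt-ValiantsHypothesis-21181) is equivalent to
the same inequality for the cofactors having, in EVERY aligned block `[2i, 2i+2b)` with `b ≥ (log₂ n + c + 2)^{6(c+1)}`,
at least one internal variable. [cite: HrubesYehudayoff2021, §6 Problem 2] -/
theorem nnDivisionHard_iff_blockDenseTier :
    Summit.ValiantsHypothesis.ValiantsHypothesis.Theses.FifoMatching.NNDivisionHard ↔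
    ∀ c : ℕ, ∃ n₀ : ℕ, ∀ n ≥ n₀, ∀ h : MvPolynomial (Fin (2 * n) × Fin (2 * n)) ℝ≥0, h ≠ 0 →
      (∀ i b : ℕ, i + b ≤ n → (Nat.log 2 n + c + 2) ^ (6 * (c + 1)) ≤ b →
        ∃ e ∈ h.vars, 2 * i ≤ (e.1 : ℕ) ∧ (e.1 : ℕ) < 2 * i + 2 * b ∧ 2 * i ≤ (e.2 : ℕ) ∧
          (e.2 : ℕ) < 2 * i + 2 * b) →
      2 ^ ((Nat.log 2 n + c) ^ c) < complexity (nestFreeMatchingPoly n ℝ≥0 * h) + complexity h := by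
  constructor
  · intro hN c
    obtain ⟨n₀, hn₀⟩ := hN c
    exact ⟨n₀, fun n hn h hh _ => hn₀ n hn h hh⟩
  · intro H c
    obtain ⟨n₀, hn₀⟩ := H c
    obtain ⟨n₁, hn₁⟩ := intervalAvoiding_not_certificate_qp c
    refine ⟨max n₀ n₁, fun n hn h hh => ?_⟩
    by_contra hcon
    apply hcon
    apply hn₀ n (le_trans (le_max_left _ _) hn) h hh
    intro i b hib hb
    by_contra hne
    exact hcon (hn₁ n (le_trans (le_max_right _ _) hn) i b hib hb h hh fun e he hP => hne ⟨e, he, hP⟩)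

end Summit.ValiantsHypothesis.ValiantsHypothesis.Theorems.FifoMatching.NNDivisionHard.BlockAvoidance

end
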